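import Summits.Ventures.Crystal3D.Theorems.StickyWulffConstantGenericWallFloorDoubleTopLocalCore
import Summits.Ventures.Crystal3D.Theorems.StickyWulffConstantGenericWallFloorCutNormals
import HarnessLib

/-!
# Double tops, local part 2: rational positive-spanning certificates and their soundness
# (crux `GenericWallFloor`, line `WallLedgerG`, residual `#DT₁₁`; local half of R39d «DoubleStarFree»)

HONEST FRAMING. Part of the venture `Summits/Ventures/Crystal3D` (cell `crystal3d-full`), helper
`--supports` the crux `GenericWallFloor` (stmt-Ventures-19480) of `route-Ventures-StickyWulffConstant`,
registered line `WallLedgerG`, open stub `stub_twoSlabAdhesion`.  Continues `…DoubleTopLocalCore`.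

SETTING (cubic frame, lengths × `√2`, so that all data are rational).  A DOUBLE TOP `e` of the chain
ledger owns two full predecessor dozens: the fixed cluster `F̂ = {(−1,−1,0)} ∪ ((−1,−1,0) + slots)`
(`clusterInt`, thirteen balls, `F̂ 1 = e = 0`) of grain 1 and the moving cluster `(1+κ)·Q` of grain 2,
where `Q = b·F̂` is its position at a CO-AXIAL reference rotation `b` (a lattice symmetry or a Σ3 twin)
and `1 + κ` (orthogonal) the residual misorientation; an eleventh neighbour of `e` is a ball `y`,
`|y|² = 2`, at distance `≥ √2` from the `24` non-centre balls.  A certificate `C : DTCert` records `b` (`B`, cubic matrix) and `Q`,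
the free slot `y₀` next to which `y` is sought (`useY`), and for each of the twelve target functionals
`±a_l, ±η_l` (indexed by a sign `s`, a kind `w` — `false` for the axis `a` of `κ`, `true` for
`η = y − y₀` — and `l : Fin 3`) rational multipliers on the linearised constraints of part 1 (contact
pairs `lamJ ≥ 0`, coincident balls `lamC` — any sign, the form vanishes —, fixed / moving cage balls
`lamF, lamM ≥ 0`, the sphere `lamSp, lamSm ≥ 0`).  `C.valid` (decidable; the data files prove it by
`decide +kernel`) checks that every weighted constraint is a genuine contact / coincidence / cage ball of
the reference configuration, that the weighted forms sum to the target (`sumA = tvA`, `sumE = tvE`), and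
that `C.Ktot ≥ (8/3) Σ_l K(a_l)² + Σ_l K(η_l)²` for the resulting constants `K = Σ λ·c`.

**`DTCert.sound`** (next file, `…DoubleTopLocalSound`).  If `C.valid`, then for every orthogonal `1 + κ` and every `y`: the two clusters
`1`-separated up to coincidence (`F̂ i = (1+κ)Q j ∨ |F̂ i − (1+κ)Q j|² ≥ 2`), `y` on the sphere and
outside the unit balls of the `24` non-centre cluster balls (when `useY`), and
`‖κ‖_F² + |y − y₀|² < 1/Ktot` ⇒ `κ = 0`: inside that ball around the reference configuration the only
double top with an eleventh neighbour is the co-axial one itself.  Mechanism: part 1 bounds every form by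
`c·U`, `U = ‖κ‖_F² + |η|²`; the certificate gives `|a_l|, |η_l| ≤ K·U`; `‖κ‖_F² ≤ (8/3)|a|²`
(`frob_le_axis_sq`); so `U ≤ Ktot·U²`, and `U < 1/Ktot` forces `U = 0`.

WHAT THIS IS NOT: the soundness proof (part 3), the certificates themselves (data files), the packaging to
`A₁, A₂, fccSlots`, the global interval half of R39d, the stub; rung F-C1 not moved.
-/

noncomputable section

namespace Summit.Ventures.Crystal3D.Theorems.NearIdentity

open Matrix

/-! ### Rational data -/

/-- The fixed cluster `F̂` (× `√2`): the predecessor `(−1,−1,0)` of the top `0` along the slot `(1,1,0)`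
and its twelve slot neighbours, in the order of `slotInt`; `clusterInt 1 = 0` is the top itself. -/
def clusterInt : Fin 13 → Fin 3 → ℤ :=
  ![![-1, -1, 0], ![0, 0, 0], ![0, -2, 0], ![-2, 0, 0], ![-2, -2, 0], ![0, -1, 1], ![0, -1, -1],
    ![-2, -1, 1], ![-2, -1, -1], ![-1, 0, 1], ![-1, 0, -1], ![-1, -2, 1], ![-1, -2, -1]]

/-- Table check: `clusterInt 0 = −(1,1,0)` and `clusterInt (k+1) = clusterInt 0 + slotInt k`. -/
theorem clusterInt_facts :
    clusterInt 0 = -slotInt 0 ∧ ∀ k : Fin 12, clusterInt k.succ = clusterInt 0 + slotInt k := by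
  decide +kernel

/-- The fixed cluster with rational entries. -/
def clusterQ (i : Fin 13) : Fin 3 → ℚ := fun l => clusterInt i l

/-- Rational cross product (the formula of `crossProduct`). -/
def crossQ (u v : Fin 3 → ℚ) : Fin 3 → ℚ :=
  ![u 1 * v 2 - u 2 * v 1, u 2 * v 0 - u 0 * v 2, u 0 * v 1 - u 1 * v 0]

/-- Rational dot product on `Fin 3` (spelled out, for fast kernel evaluation). -/
def dotQ (u v : Fin 3 → ℚ) : ℚ := u 0 * v 0 + u 1 * v 1 + u 2 * v 2

/-- The standard basis vectors. -/
def basisQ (m : Fin 3) : Fin 3 → ℚ := fun l => if l = m then 1 else 0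

/-- The sign of a target. -/
def sgnQ (s : Bool) : ℚ := if s then -1 else 1

/-- Target table, `a`-part: target `(s, w, l)` is `sgn(s)·a_l` if `w = false`. -/
def tvA (s w : Bool) (l l' : Fin 3) : ℚ := if w = false ∧ l' = l then sgnQ s else 0

/-- Target table, `η`-part: target `(s, w, l)` is `sgn(s)·η_l` if `w = true`. -/
def tvE (s w : Bool) (l l' : Fin 3) : ℚ := if w = true ∧ l' = l then sgnQ s else 0

/-- A local rigidity certificate for one reference configuration (see the module docstring).  Targets
are indexed by `(s, w, l)`: sign, kind (`false` = axis coordinate `a_l`, `true` = `η_l`), coordinate. -/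
structure DTCert where
  /-- the reference (co-axial) rotation `b`, as a matrix in the cubic frame -/
  B : Fin 3 → Fin 3 → ℚ
  /-- moving cluster at the reference rotation, `Q j = b · F̂ j`, × `√2` -/
  Q : Fin 13 → Fin 3 → ℚ
  /-- the free slot next to which the eleventh ball is sought, × `√2` -/
  y0 : Fin 3 → ℚ
  /-- whether the eleventh ball is used at all -/
  useY : Bool
  /-- multipliers: contact pairs (fixed `i`, moving `j`) -/
  lamJ : Bool → Bool → Fin 3 → Fin 13 → Fin 13 → ℚ
  /-- multipliers: coincident moving ball `j`, direction `m` (any sign) -/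
  lamC : Bool → Bool → Fin 3 → Fin 13 → Fin 3 → ℚ
  /-- multipliers: fixed cage balls -/
  lamF : Bool → Bool → Fin 3 → Fin 13 → ℚ
  /-- multipliers: moving cage balls -/
  lamM : Bool → Bool → Fin 3 → Fin 13 → ℚ
  /-- multipliers: sphere form `y₀ ⬝ η ≤ 0` -/
  lamSp : Bool → Bool → Fin 3 → ℚ
  /-- multipliers: sphere form `−y₀ ⬝ η ≤ |η|²/2` -/
  lamSm : Bool → Bool → Fin 3 → ℚ
  /-- the final constant: rigidity inside `‖κ‖_F² + |y − y₀|² < 1/Ktot` -/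
  Ktot : ℚ

namespace DTCert

variable (C : DTCert)

/-- Remainder constant of a contact form: `(|F̂ i|² + |Q j|²)/4`. -/
def cJ (i j : Fin 13) : ℚ := (dotQ (clusterQ i) (clusterQ i) + dotQ (C.Q j) (C.Q j)) / 4

/-- Remainder constant of a moving cage form: `max 1 ((3|Q j|² + |y₀|²)/4)`. -/
def cM (j : Fin 13) : ℚ := max 1 ((3 * dotQ (C.Q j) (C.Q j) + dotQ C.y0 C.y0) / 4)

/-- The constant of target `(s, w, l)`: `Σ λ·c`. -/
def K (s w : Bool) (l : Fin 3) : ℚ :=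
  (∑ i, ∑ j, C.lamJ s w l i j * C.cJ i j) + (∑ i, C.lamF s w l i * (1 / 2)) +
    (∑ j, C.lamM s w l j * C.cM j) + C.lamSm s w l * (1 / 2)

/-- `a`-part of the weighted sum of forms of target `(s, w, l)`, component `l'`. -/
def sumA (s w : Bool) (l l' : Fin 3) : ℚ :=
  (∑ i, ∑ j, C.lamJ s w l i j * crossQ (C.Q j) (clusterQ i) l') +
    (∑ j, ∑ m, C.lamC s w l j m * crossQ (C.Q j) (basisQ m) l') + ∑ j, C.lamM s w l j * crossQ (C.Q j) C.y0 l'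

/-- `η`-part of the weighted sum of forms of target `(s, w, l)`, component `l'`. -/
def sumE (s w : Bool) (l l' : Fin 3) : ℚ :=
  (∑ i, C.lamF s w l i * (clusterQ i l' - C.y0 l')) + (∑ j, C.lamM s w l j * (C.Q j l' - C.y0 l')) +
    (C.lamSp s w l - C.lamSm s w l) * C.y0 l'

/-- The larger of the two constants of the `±` targets of kind `w`, coordinate `l`. -/
def Kmax (w : Bool) (l : Fin 3) : ℚ := max (C.K false w l) (C.K true w l)

/-- Rational matrix–vector product on `Fin 3`. -/
def mulQ (M : Fin 3 → Fin 3 → ℚ) (v : Fin 3 → ℚ) : Fin 3 → ℚ :=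
  fun i => M i 0 * v 0 + M i 1 * v 1 + M i 2 * v 2

/-- Validity, part 0: `B` is orthogonal (both ways) and `Q = B·F̂`. -/
def validB : Prop :=
  (∀ i j : Fin 3, C.B 0 i * C.B 0 j + C.B 1 i * C.B 1 j + C.B 2 i * C.B 2 j = if i = j then 1 else 0) ∧
  (∀ i j : Fin 3, C.B i 0 * C.B j 0 + C.B i 1 * C.B j 1 + C.B i 2 * C.B j 2 = if i = j then 1 else 0) ∧
  (∀ j, C.Q j = mulQ C.B (clusterQ j))

/-- Validity, part 1: sizes and the final constant. -/
def validSize : Prop :=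
  (∀ j, dotQ (C.Q j) (C.Q j) ≤ 8) ∧ (C.useY = true → dotQ C.y0 C.y0 = 2) ∧ 4 ≤ C.Ktot ∧
  (8 / 3 * ((C.Kmax false 0) ^ 2 + (C.Kmax false 1) ^ 2 + (C.Kmax false 2) ^ 2) +
      (if C.useY then (C.Kmax true 0) ^ 2 + (C.Kmax true 1) ^ 2 + (C.Kmax true 2) ^ 2 else 0) ≤ C.Ktot)

/-- Validity, part 2: the weighted contact pairs are contacts. -/
def validJ : Prop :=
  ∀ s w l i j, C.lamJ s w l i j ≠ 0 → 0 < C.lamJ s w l i j ∧ dotQ (clusterQ i - C.Q j) (clusterQ i - C.Q j) = 2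

/-- Validity, part 3: the weighted coincidences are coincidences. -/
def validC : Prop := ∀ s w l j m, C.lamC s w l j m ≠ 0 → ∃ i, clusterQ i = C.Q j

/-- Validity, part 4: the weighted fixed cage balls. -/
def validF : Prop :=
  ∀ s w l i, C.lamF s w l i ≠ 0 → 0 < C.lamF s w l i ∧ C.useY = true ∧ clusterQ i ≠ 0 ∧
    dotQ (C.y0 - clusterQ i) (C.y0 - clusterQ i) = 2

/-- Validity, part 5: the weighted moving cage balls. -/
def validM : Prop :=
  ∀ s w l j, C.lamM s w l j ≠ 0 → 0 < C.lamM s w l j ∧ C.useY = true ∧ C.Q j ≠ 0 ∧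
    dotQ (C.y0 - C.Q j) (C.y0 - C.Q j) = 2

/-- Validity, part 6: the sphere multipliers. -/
def validS : Prop :=
  ∀ s w l, 0 ≤ C.lamSp s w l ∧ 0 ≤ C.lamSm s w l ∧ ((C.lamSp s w l ≠ 0 ∨ C.lamSm s w l ≠ 0) → C.useY = true)

/-- Validity, part 7: the weighted forms sum to the targets (η-targets only when the ball is used). -/
def validId : Prop :=
  ∀ s w l, (w = false ∨ C.useY = true) → (∀ l', C.sumA s w l l' = tvA s w l l') ∧ (∀ l', C.sumE s w l l' = tvE s w l l')

/-- Validity of a certificate (decidable; proved by `decide +kernel` in the data files). -/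
def valid : Prop :=
  C.validSize ∧ C.validJ ∧ C.validC ∧ C.validF ∧ C.validM ∧ C.validS ∧ C.validId ∧ C.validB

/-- `validB` is decidable. -/
instance : Decidable C.validB := by unfold validB; infer_instance
/-- `validSize` is decidable. -/
instance : Decidable C.validSize := by unfold validSize; infer_instance
/-- `validJ` is decidable. -/
instance : Decidable C.validJ := by unfold validJ; infer_instance
/-- `validC` is decidable. -/
instance : Decidable C.validC := by unfold validC; infer_instance
/-- `validF` is decidable. -/
instance : Decidable C.validF := by unfold validF; infer_instance
/-- `validM` is decidable. -/
instance : Decidable C.validM := by unfold validM; infer_instance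
/-- `validS` is decidable. -/
instance : Decidable C.validS := by unfold validS; infer_instance
/-- `validId` is decidable. -/
instance : Decidable C.validId := by unfold validId; infer_instance
/-- `valid` is decidable (the data files use `decide +kernel`). -/
instance : Decidable C.valid := by unfold valid; infer_instance

end DTCert


/-! ### Sparse tables for the data files -/

/-- Sparse multiplier table on `(s, w, l, i, j)`. -/
def lk5 (L : List (Bool × Bool × Fin 3 × Fin 13 × Fin 13 × ℚ)) :
    Bool → Bool → Fin 3 → Fin 13 → Fin 13 → ℚ := fun s w l i j =>
  (L.find? fun e => e.1 == s && e.2.1 == w && e.2.2.1 == l && e.2.2.2.1 == i && e.2.2.2.2.1 == j).elim 0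
    fun e => e.2.2.2.2.2

/-- Sparse multiplier table on `(s, w, l, j, m)`. -/
def lk5c (L : List (Bool × Bool × Fin 3 × Fin 13 × Fin 3 × ℚ)) :
    Bool → Bool → Fin 3 → Fin 13 → Fin 3 → ℚ := fun s w l j m =>
  (L.find? fun e => e.1 == s && e.2.1 == w && e.2.2.1 == l && e.2.2.2.1 == j && e.2.2.2.2.1 == m).elim 0
    fun e => e.2.2.2.2.2

/-- Sparse multiplier table on `(s, w, l, i)`. -/
def lk4 (L : List (Bool × Bool × Fin 3 × Fin 13 × ℚ)) : Bool → Bool → Fin 3 → Fin 13 → ℚ := fun s w l i =>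
  (L.find? fun e => e.1 == s && e.2.1 == w && e.2.2.1 == l && e.2.2.2.1 == i).elim 0 fun e => e.2.2.2.2

/-- Sparse multiplier table on `(s, w, l)`. -/
def lk3 (L : List (Bool × Bool × Fin 3 × ℚ)) : Bool → Bool → Fin 3 → ℚ := fun s w l =>
  (L.find? fun e => e.1 == s && e.2.1 == w && e.2.2.1 == l).elim 0 fun e => e.2.2.2

/-! ### Real semantics and cast lemmas -/

/-- Real vector of a rational one. -/
def castVec (u : Fin 3 → ℚ) : Fin 3 → ℝ := fun l => ((u l : ℚ) : ℝ)

/-- The fixed cluster as real vectors. -/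
def fR (i : Fin 13) : Fin 3 → ℝ := castVec (clusterQ i)

namespace DTCert
variable (C : DTCert)
/-- The moving cluster at the reference rotation as real vectors. -/
def qR (j : Fin 13) : Fin 3 → ℝ := castVec (C.Q j)
/-- The free slot as a real vector. -/
def y0R : Fin 3 → ℝ := castVec C.y0
end DTCert

/-- `castVec` respects subtraction. -/
theorem castVec_sub (u v : Fin 3 → ℚ) : castVec (u - v) = castVec u - castVec v := by
  ext l; simp [castVec]

/-- Components of `castVec`. -/
theorem castVec_apply (u : Fin 3 → ℚ) (l : Fin 3) : castVec u l = ((u l : ℚ) : ℝ) := rfl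

/-- `dotQ` casts to the real dot product. -/
theorem cast_dotQ (u v : Fin 3 → ℚ) : ((dotQ u v : ℚ) : ℝ) = castVec u ⬝ᵥ castVec v := by
  simp only [dotQ, dotProduct, Fin.sum_univ_three, castVec]; push_cast; ring

/-- `crossQ` casts to the real cross product. -/
theorem cast_crossQ (u v : Fin 3 → ℚ) (l : Fin 3) :
    ((crossQ u v l : ℚ) : ℝ) = crossProduct (castVec u) (castVec v) l := by
  fin_cases l <;> simp [crossQ, cross_apply, castVec]

/-- The basis vectors cast to `Pi.single`. -/
theorem castVec_basisQ (m : Fin 3) : castVec (basisQ m) = Pi.single m (1 : ℝ) := by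
  ext l; simp only [castVec, basisQ, Pi.single_apply]; split_ifs <;> simp

/-- Linearity: a weighted sum of `a ⬝ vᵢ` regrouped by the coordinates of `a`. -/
theorem sum_mul_dot {ι : Type*} (s : Finset ι) (c : ι → ℝ) (v : ι → Fin 3 → ℝ) (a : Fin 3 → ℝ) :
    ∑ i ∈ s, c i * (a ⬝ᵥ v i) = ∑ l : Fin 3, (∑ i ∈ s, c i * v i l) * a l := by
  simp only [dotProduct, Fin.sum_univ_three, Finset.sum_mul, ← Finset.sum_add_distrib]
  exact Finset.sum_congr rfl fun i _ => by ring

/-- Linearity for the `η`-forms. -/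
theorem sum_mul_dot' {ι : Type*} (s : Finset ι) (c : ι → ℝ) (v : ι → Fin 3 → ℝ) (η : Fin 3 → ℝ) :
    ∑ i ∈ s, c i * (v i ⬝ᵥ η) = ∑ l : Fin 3, (∑ i ∈ s, c i * v i l) * η l := by
  simp only [dotProduct, Fin.sum_univ_three, Finset.sum_mul, ← Finset.sum_add_distrib]
  exact Finset.sum_congr rfl fun i _ => by ring

/-- The value of target `(s, w, l)` on `(a, η)`. -/
theorem target_value (s w : Bool) (l : Fin 3) (a η : Fin 3 → ℝ) :
    (∑ l', ((tvA s w l l' : ℚ) : ℝ) * a l') + ∑ l', ((tvE s w l l' : ℚ) : ℝ) * η l' =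
      ((sgnQ s : ℚ) : ℝ) * (if w then η l else a l) := by
  cases w <;> cases s <;> fin_cases l <;> simp [tvA, tvE, sgnQ, Fin.sum_univ_three]

/-- `u ≤ M·U` and `−u ≤ M·U` give `u² ≤ M² U²`. -/
theorem sq_le_of_abs_le {u M U : ℝ} (h1 : u ≤ M * U) (h2 : -u ≤ M * U) : u ^ 2 ≤ M ^ 2 * U ^ 2 := by
  nlinarith [mul_nonneg (sub_nonneg.2 h1) (show 0 ≤ M * U + u by linarith)]

end Summit.Ventures.Crystal3D.Theorems.NearIdentity

end
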